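import Literature.MathematicalPhysics.QuantumFieldTheory.VillainAngleForm
import Literature.MathematicalPhysics.QuantumFieldTheory.VillainFibre
import Literature.MathematicalPhysics.QuantumFieldTheory.PlaquetteChains
import Literature.Probability.LatticeModels.PeriodicUnfolding
import Literature.Probability.LatticeModels.GaussianLinearImage
import HarnessLib

/-!
# The real coboundary `θ ↦ dθ̃` on the plaquettes of a cube as a matrix; its Gram matrix and the
# variational bound on the spin-wave energy of a sheet

Support file for the duality transformation of four-dimensional `U(1)` lattice gauge theory with
the Villain action (proof programme of the named fact
`Literature.MathematicalPhysics.QuantumFieldTheory.FrohlichSpencerU1PerimeterLawD4` and of its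
corollary `Literature.Barriers.QuantumFields.AbelianDeconfinementD4`). The Gaussian (spin-wave)
part of the dual model (FS82 §2.5, §2.7) is governed by the linear map `T : θ ↦ dθ̃` from real
angles on the free links of `B_n` to real plaquette fields (`VillainAngleForm.extAngle`,
`LatticeForm.d₁`); this file packages it for `GaussianLinearImage`:

* `PIdx d n`, `FIdx d n` (plaquettes / free edges of `B_n` as index types), `dFreeR` (the linear
  map), `dFreeR_injective` (comb-gauge uniqueness over `ℝ`), `dMat = toMatrix' dFreeR`,
  `posDef_gram_dMat` (`TᵀT` is positive definite), `dFreeR_intCast`/`dFreeR_add_shift`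
  (compatibility with the integer coboundary `VillainFibre.dFree` and the shifts `2πℓ`);
* generic complements to `GaussianLinearImage`: `exactPart_dotProduct_self`
  (`‖P_E w‖² = E_T(w)`) and the **variational bound**
  `exactEnergy_le_dotProduct_sub : Tᵀc = 0 → E_T(w) ≤ ‖w - c‖²` (FS82 (2.51)–(2.52): `ε_Λ` is the
  minimiser);
* the **adjointness** `dotProduct_dFreeR_eq_zero_of_closed : div₂ (fluxChain c) = 0 → ⟨dθ̃, c⟩ = 0`
  (summation by parts `CubicalChainsPairing.pair₁_div₂` with `PlaquetteChains.pair₂_fluxChain_left`),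
  hence `transpose_dMat_mulVec_eq_zero_of_closed` and
  `exactEnergy_dMat_le_of_closed : E_T(S) ≤ ‖S - c‖²` for every closed real plaquette field `c`
  of `B_n` — the bridge to the sheet-energy estimate `(ε_Λ, ε_Λ) ≤ const (L + T)` ((2.88);
  `U1CoulombSheetEnergy`, `U1CoulombEnergy`).

Everything is proved; no named fact is introduced.

## References

* J. Fröhlich, T. Spencer, Comm. Math. Phys. 83 (1982) 411–454, §2.5 (2.32)–(2.36), §2.7
  (2.50)–(2.52), §2.10 (2.88). [FrohlichSpencerCMP1982]
-/

noncomputable section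

open Finset Function Matrix
open scoped Real
open Literature.Probability.LatticeModels
open Literature.Probability.LatticeModels.GaussianCoord (gram exactPart perpPart exactPreimage exactEnergy)

namespace Literature.MathematicalPhysics.QuantumFieldTheory

/-- Sites of `ℤ^d` (the namespace-local `Site` is the torus one). -/
local notation "ZSite" => Literature.Probability.LatticeModels.Site

namespace VillainAngle

open AxialGauge LatticeForm LatticeChain VillainFibre

variable {d n : ℕ}

/-! ### The coboundary as a linear map and a matrix -/

variable (d n) in
/-- The plaquettes of `B_n` as an index type. [folklore] -/
abbrev PIdx : Type := ↥(plaquettesIn (halfOpenBox d n))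

variable (d n) in
/-- The free (non-comb) edges of `B_n` as an index type. [folklore] -/
abbrev FIdx : Type := {e : ↥(boxEdges d n) // ¬ IsComb e.1}

/-- **The real plaquette field `(dθ̃)_p` of the free link angles**, as a linear map
`ℝ^{E¹_n} → ℝ^{P_n}`. [cite: FrohlichSpencerCMP1982, §2.2 (2.3)] -/
def dFreeR : (FIdx d n → ℝ) →ₗ[ℝ] (PIdx d n → ℝ) where
  toFun θ p := d₁ (extAngle θ) p.1.1 p.1.2.1 p.1.2.2
  map_add' θ θ' := by
    funext p
    simp only [extAngle_add, Pi.add_apply, d₁]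
    ring
  map_smul' c θ := by
    funext p
    simp only [extAngle_smul, RingHom.id_apply, Pi.smul_apply, smul_eq_mul, d₁]
    ring

/-- Unfolding `dFreeR`. [folklore] -/
theorem dFreeR_apply (θ : FIdx d n → ℝ) (p : PIdx d n) :
    dFreeR θ p = d₁ (extAngle θ) p.1.1 p.1.2.1 p.1.2.2 := rfl

/-- **`θ ↦ dθ̃` is injective on the free link angles** (uniqueness in the comb gauge over `ℝ`,
`LatticeForm.d₁_injective_of_comb`). [folklore] -/
theorem dFreeR_injective : Function.Injective (dFreeR (d := d) (n := n)) := by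
  intro θ θ' h
  have hcomb : ∀ (η : FIdx d n → ℝ) (x : ZSite d) (i : Fin d),
      (∀ m : Fin d, i.val < m.val → x m = (0 : ZSite d) m) → extAngle η x i = 0 := by
    intro η x i hx
    simp only [extAngle]
    split_ifs with h1 hc
    · rfl
    · exact absurd (fun k hk => hx k hk) hc
    · rfl
  have key := d₁_injective_of_comb (extAngle θ) (extAngle θ') 0 (VillainFibre.top d n) (hcomb θ)
    (hcomb θ') (fun x i j hij hx hxij => by
      have hp : (x, i, j) ∈ plaquettesIn (halfOpenBox d n) :=
        VillainFibre.mem_plaquettesIn_iff.2 ⟨hij, VillainFibre.mem_halfOpenBox_iff_mem_Icc.2 hx,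
          VillainFibre.mem_halfOpenBox_iff_mem_Icc.2 hxij⟩
      have := congrFun h ⟨(x, i, j), hp⟩
      simpa [dFreeR_apply] using this)
  funext e
  obtain ⟨⟨⟨x, i⟩, he⟩, hc⟩ := e
  have hx := mem_boxEdges.1 he
  have := key x i (VillainFibre.mem_halfOpenBox_iff_mem_Icc.1 hx.1)
    (VillainFibre.mem_halfOpenBox_iff_mem_Icc.1 hx.2)
  rwa [extAngle_apply θ ⟨⟨(x, i), he⟩, hc⟩, extAngle_apply θ' ⟨⟨(x, i), he⟩, hc⟩] at this

/-- **The matrix `T` of `θ ↦ dθ̃`** (rows: plaquettes of `B_n`; columns: free edges). [folklore] -/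
def dMat : Matrix (PIdx d n) (FIdx d n) ℝ := LinearMap.toMatrix' dFreeR

/-- `T θ = dθ̃`. [folklore] -/
theorem dMat_mulVec (θ : FIdx d n → ℝ) : dMat *ᵥ θ = dFreeR θ := by
  rw [dMat, LinearMap.toMatrix'_mulVec]

/-- **The Gram matrix `TᵀT` is positive definite** (`T` is injective). [folklore] -/
theorem posDef_gram_dMat : (gram (dMat (d := d) (n := n))).PosDef := by
  have h := Matrix.PosDef.conjTranspose_mul_self (dMat (d := d) (n := n)) (fun θ θ' hθ => by
    rw [dMat_mulVec, dMat_mulVec] at hθ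
    exact dFreeR_injective hθ)
  rwa [Matrix.conjTranspose_eq_transpose_of_trivial] at h

/-- The real coboundary of an integer free link field is its integer coboundary. [folklore] -/
theorem dFreeR_intCast (ℓ : FreeInt d n) :
    dFreeR (fun e => (ℓ e : ℝ)) = fun p => (dFree ℓ p : ℝ) := by
  funext p
  rw [dFreeR_apply, dFree_apply]
  have hext : extAngle (fun e : FIdx d n => (ℓ e : ℝ)) = fun x i => (extFree ℓ x i : ℝ) := by
    funext x i
    simp only [extAngle, extFree]
    split_ifs <;> simp
  rw [hext]
  simp only [d₁]
  push_cast
  ring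

/-- `d(θ + 2πℓ)̃ = dθ̃ + 2π dℓ` for an integer free link field `ℓ`. [folklore] -/
theorem dFreeR_add_shift (θ : FIdx d n → ℝ) (ℓ : FreeInt d n) :
    dFreeR (θ + PeriodicUnfolding.shift ℓ) = dFreeR θ + (2 * Real.pi) • fun p => (dFree ℓ p : ℝ) := by
  have hshift : PeriodicUnfolding.shift ℓ = (2 * Real.pi) • fun e : FIdx d n => (ℓ e : ℝ) := by
    funext e; simp [PeriodicUnfolding.shift]
  rw [map_add, hshift, map_smul, dFreeR_intCast]

/-! ### Generic complements: the exact part realises the spin-wave energy; variational bound -/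

section Generic

variable {ι κ : Type*} [Fintype ι] [Fintype κ] [DecidableEq ι]

/-- `‖P_E w‖² = E_T(w)`. [cite: FrohlichSpencerCMP1982, §2.7 (2.52)] -/
theorem exactPart_dotProduct_self (T : Matrix κ ι ℝ) (hM : (gram T).PosDef) (w : κ → ℝ) :
    exactPart T w ⬝ᵥ exactPart T w = exactEnergy T w := by
  have hdet : IsUnit (gram T).det := (Matrix.isUnit_iff_isUnit_det _).1 hM.isUnit
  have hGv : GaussianCoord.gram T *ᵥ ((GaussianCoord.gram T)⁻¹ *ᵥ (Tᵀ *ᵥ w)) = Tᵀ *ᵥ w := by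
    rw [Matrix.mulVec_mulVec, Matrix.mul_nonsing_inv _ hdet, Matrix.one_mulVec]
  unfold GaussianCoord.exactPart GaussianCoord.exactEnergy
  rw [GaussianCoord.mulVec_dotProduct_self, hGv, dotProduct_comm]

/-- **Variational bound**: for `c` orthogonal to the range of `T` (`Tᵀc = 0`),
`E_T(w) ≤ ‖w - c‖²` — the exact part of `w` is the nearest point of the range, and `ε_Λ` minimises.
[cite: FrohlichSpencerCMP1982, §2.7 (2.51)–(2.52)] -/
theorem exactEnergy_le_dotProduct_sub (T : Matrix κ ι ℝ) (hM : (gram T).PosDef) (w c : κ → ℝ)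
    (hc : Tᵀ *ᵥ c = 0) : exactEnergy T w ≤ (w - c) ⬝ᵥ (w - c) := by
  have hsplit : w - c = exactPart T w + (perpPart T w - c) := by
    rw [perpPart]; abel
  have hcross : exactPart T w ⬝ᵥ (perpPart T w - c) = 0 := by
    rw [exactPart, GaussianCoord.mulVec_dotProduct_eq, Matrix.mulVec_sub,
      GaussianCoord.transpose_mulVec_perpPart T hM, hc, sub_zero, dotProduct_zero]
  rw [hsplit, add_dotProduct, dotProduct_add, dotProduct_add, hcross, dotProduct_comm (perpPart T w - c),
    hcross, exactPart_dotProduct_self T hM, add_zero, zero_add, le_add_iff_nonneg_right]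
  exact Finset.sum_nonneg fun i _ => mul_self_nonneg _

end Generic

/-! ### Adjointness with the chain boundary and the sheet-energy bridge -/

/-- `d₁θ̃` is an alternating real 2-tensor. [folklore] -/
theorem isAltR₂_d₁_extAngle (θ : FIdx d n → ℝ) : IsAltR₂ (d₁ (extAngle θ)) :=
  fun y i j => d₁_swap _ y i j

/-- **Adjointness**: `⟨dθ̃, c⟩ = ⟪div₂ (fluxChain c), θ̃⟫₁`; in particular `⟨dθ̃, c⟩ = 0` for a
closed real plaquette field `c` of `B_n`. [cite: FrohlichSpencerCMP1982, §2.3 (2.15) (summation by parts)] -/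
theorem dotProduct_dFreeR_eq_zero_of_closed (θ : FIdx d n → ℝ) (c : PIdx d n → ℝ)
    (hc : div₂ (fluxChain (halfOpenBox d n) c) = 0) : dFreeR θ ⬝ᵥ c = 0 := by
  have h1 : dFreeR θ ⬝ᵥ c = pair₂ (fluxChain (halfOpenBox d n) c) (d₁ (extAngle θ)) := by
    rw [pair₂_fluxChain_left c (isAltR₂_d₁_extAngle θ), dotProduct]
    exact Finset.sum_congr rfl fun p _ => by rw [dFreeR_apply, mul_comm]
  rw [h1, ← pair₁_div₂ (hasFiniteSupport_fluxChain c) (isAltR₂_fluxChain c), hc]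
  simp [pair₁]

/-- `Tᵀ c = 0` for a closed real plaquette field `c` of `B_n`. [folklore] -/
theorem transpose_dMat_mulVec_eq_zero_of_closed (c : PIdx d n → ℝ)
    (hc : div₂ (fluxChain (halfOpenBox d n) c) = 0) : (dMat (d := d) (n := n))ᵀ *ᵥ c = 0 := by
  have h : ∀ θ : FIdx d n → ℝ, θ ⬝ᵥ ((dMat (d := d) (n := n))ᵀ *ᵥ c) = 0 := fun θ => by
    rw [← GaussianCoord.mulVec_dotProduct_eq, dMat_mulVec, dotProduct_dFreeR_eq_zero_of_closed θ c hc]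
  exact dotProduct_self_eq_zero.1 (h _)

/-- **The sheet-energy bridge**: for every closed real plaquette field `c` of `B_n`,
`E_T(S) ≤ ‖S - c‖² = ∑_p (S_p - c_p)²` — so the spin-wave energy of a sheet is bounded by its
distance to any closed competitor (FS82 (2.88) via `U1CoulombSheetEnergy`).
[cite: FrohlichSpencerCMP1982, §2.7 (2.51)–(2.52), §2.10 (2.88)] -/
theorem exactEnergy_dMat_le_of_closed (S c : PIdx d n → ℝ)
    (hc : div₂ (fluxChain (halfOpenBox d n) c) = 0) :
    exactEnergy (dMat (d := d) (n := n)) S ≤ ∑ p, (S p - c p) ^ 2 := by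
  have h := exactEnergy_le_dotProduct_sub dMat posDef_gram_dMat S c
    (transpose_dMat_mulVec_eq_zero_of_closed c hc)
  refine h.trans (le_of_eq ?_)
  simp only [dotProduct, Pi.sub_apply, sq]

end VillainAngle

end Literature.MathematicalPhysics.QuantumFieldTheory
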